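import Mathlib
import HarnessLib
import Summits.Parity.GeneralizedHardyLittlewood.Theorems.DilatedChowla.Negative.DilatedChowlaMirrorOnePointDefs
import Summits.Parity.GeneralizedHardyLittlewood.Theorems.DilatedChowla.Negative.DilatedChowlaMirrorMoebiusExcData
import Literature.NumberTheory.LFunctions.MoebiusCharacterSumBoundProofs
import Literature.NumberTheory.LFunctions.InvLFunctionLinnikBox

/-!
# `DilatedChowla` (stmt-Parity-13319): the exceptional-character Möbius law `moebiusExcLaw`

Line `Sketch` (card `siegel-mirror`), stub A, part 2 of 2.  For a real character `ψ ≠ 1 mod k` with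
a real zero `β ∈ (1 − c₁/log(4k), 1)` of `L(s, ψ)` we prove (`MoebiusExcLaw c₁ C₁ C₂` with absolute
constants): `0 < L'(β, ψ) ≤ C₂ (1 + log k)²` and, for `x ≥ exp(C₁ (1 + log k)²)`,
`‖Mtw ψ x − x^β/(β L'(β, ψ))‖ ≤ x/k⁶`, `Mtw ψ x = Σ_{n ≤ x} μ(n)ψ(n)`.

* The asymptotic: the explicit Landau data `mexc_excPsiData` (part 1) for `1 + λ ψ(n)μ(n)`,
  `λ = 1/(K log 4k + 1)`, fed to the tree's engine `ExcPsiData.exists_psi_bound`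
  (Montgomery–Vaughan Theorem 11.16): `⌊x⌋ + λ M = x + λ x^β/(β L'(β,ψ)) + O(x e^{−(c/80)√log x})`
  for `log k ≤ √log x`; the bookkeeping `mexc_final_bound` turns this into `x/k⁶` for
  `log x ≥ C₁ (1 + log k)²`.
* Positivity of `L'(β, ψ)`: `L(σ, ψ)` is real, vanishes at `β`, and is positive on `(β, 1]`
  (no further zero there by Landau–Page uniqueness at the same `c₁`; tree
  `DirichletAbel.LFunction_ofReal_re_pos_of_forall_ne_zero`), so the right slope at `β` is `≥ 0`,
  and `L'(β, ψ) ≠ 0`.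
* The upper bound: Cauchy's estimate on the circle `|w − β| = 1/(16(1 + log k))` with the hybrid
  bound `‖L(w, ψ)‖ ≤ e k^η ‖w‖ (log k + 5)`, `η = 1/(4(1 + log k))` (tree
  `InvLFunctionDisc.norm_LFunction_le_hybrid`).
No cited facts: everything rests on proved tree theorems and Mathlib.
-/

noncomputable section

namespace Summit.Parity.GeneralizedHardyLittlewood.Theorems.DilatedChowla.Negative

open Complex Filter Topology Metric Set Finset
open scoped ArithmeticFunction.Moebius
open Literature.NumberTheory.LFunctions

/-! ## The twisted Möbius sum of a real character is real -/

/-- `Mtw Ξ x = Σ_{0 < n ≤ ⌊x⌋} Ξ(n) μ(n)` (reindexing `Icc 1 = Ioc 0` and commuting the product,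
to match the tree's `MoebiusTwist.psi_coeff_eq`). -/
theorem mexc_Mtw_eq {k : ℕ} (Ξ : DirichletCharacter ℂ k) (x : ℝ) :
    Mtw Ξ x = ∑ n ∈ Finset.Ioc 0 ⌊x⌋₊, Ξ (n : ZMod k) * (μ n : ℂ) := by
  have hIcc : Finset.Icc 1 ⌊x⌋₊ = Finset.Ioc 0 ⌊x⌋₊ := rfl
  rw [Mtw, hIcc]
  exact Finset.sum_congr rfl fun n _ ↦ mul_comm _ _

/-- For a real character `ψ` (`ψ² = 1`, so `ψ(n) ∈ {0, ±1}`) the twisted Möbius sum is real. -/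
theorem mexc_Mtw_im {k : ℕ} {ψ : DirichletCharacter ℂ k} (hψ2 : ψ ^ 2 = 1) (x : ℝ) :
    (Mtw ψ x).im = 0 := by
  rw [Mtw, Complex.im_sum]
  refine Finset.sum_eq_zero fun n _ ↦ ?_
  rw [Complex.mul_im, DirichletAbel.apply_im_eq_zero ψ hψ2, mul_zero, zero_add,
    Complex.intCast_im, zero_mul]

/-! ## `L'(β, ψ) > 0` at the exceptional zero -/

/-- **Sign of `L'(β, ψ)`.**  Let `ψ ≠ 1` be real, `0 < β < 1`, `L(β, ψ) = 0`, `L'(β, ψ) ≠ 0`, and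
suppose `L(σ, ψ) ≠ 0` for `β < σ ≤ 1`.  Then `L'(β, ψ) > 0`: the real function `σ ↦ Re L(σ, ψ)`
vanishes at `β`, is positive on `(β, 1]` (tree `DirichletAbel.LFunction_ofReal_re_pos_of_forall_ne_zero`,
continuity from `L(2, ψ) > 0`), and has derivative `Re L'(β, ψ)` at `β`, which is therefore `≥ 0`;
and `L'(β, ψ)` is real and non-zero. -/
theorem mexc_deriv_re_pos {k : ℕ} [NeZero k] (ψ : DirichletCharacter ℂ k) (hψ : ψ ≠ 1)
    (hψ2 : ψ ^ 2 = 1) {β : ℝ} (hβ0 : 0 < β) (hβ1 : β < 1) (hL : ψ.LFunction β = 0)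
    (hd : deriv ψ.LFunction β ≠ 0) (hno : ∀ σ : ℝ, β < σ → σ ≤ 1 → ψ.LFunction σ ≠ 0) :
    0 < (deriv ψ.LFunction β).re := by
  have hdiff := DirichletCharacter.differentiable_LFunction hψ
  have hder : HasDerivAt (fun σ : ℝ ↦ (ψ.LFunction σ).re) (deriv ψ.LFunction β).re β :=
    (hdiff.differentiableAt (x := (β : ℂ))).hasDerivAt.real_of_complex
  have hpos : ∀ σ : ℝ, β < σ → σ ≤ 1 → 0 < (ψ.LFunction σ).re := fun σ h1 h2 ↦
    DirichletAbel.LFunction_ofReal_re_pos_of_forall_ne_zero ψ hψ hψ2 (hβ0.trans h1) h2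
      (fun σ' h1' h2' ↦ hno σ' (h1.trans_le h1') h2')
  have htend : Tendsto (slope (fun σ : ℝ ↦ (ψ.LFunction σ).re) β) (𝓝[>] β)
      (𝓝 (deriv ψ.LFunction β).re) :=
    (hasDerivAt_iff_tendsto_slope_left_right.1 hder).2
  have hev : ∀ᶠ σ in 𝓝[>] β, 0 ≤ slope (fun σ : ℝ ↦ (ψ.LFunction σ).re) β σ := by
    filter_upwards [Ioo_mem_nhdsGT hβ1] with σ hσ
    rw [slope_def_field]
    simp only [hL, Complex.zero_re, sub_zero]
    exact div_nonneg (hpos σ hσ.1 hσ.2.le).le (by linarith [hσ.1])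
  have hge : 0 ≤ (deriv ψ.LFunction β).re := ge_of_tendsto htend hev
  have him : (deriv ψ.LFunction β).im = 0 := MoebiusTwist.deriv_LFunction_ofReal_im ψ hψ hψ2 β
  have hne : (deriv ψ.LFunction β).re ≠ 0 := by
    intro h0
    exact hd (Complex.ext (by simpa using h0) (by simpa using him))
  exact lt_of_le_of_ne hge (Ne.symm hne)

/-! ## `L'(β, ψ) ≪ (1 + log k)²` by Cauchy's estimate -/

/-- **Cauchy's estimate for `L'(β, ψ)`.**  For `ψ ≠ 1 mod k` and real `β ≤ 1` with
`β > 1 − 3/(16(1 + log k))`: `‖L'(β, ψ)‖ ≤ 160 e² (1 + log k)²`.  On the circle `|w − β| = r`,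
`r = 1/(16(1 + log k))`, one has `Re w > 1 − 4r`, `‖w‖ ≤ 2`, so the tree's hybrid bound
(`InvLFunctionDisc.norm_LFunction_le_hybrid` with `η = 4r ≤ 1/4`, `k^{4r} ≤ e`) gives
`‖L(w, ψ)‖ ≤ 2e²(log k + 5)`, and `‖L'(β, ψ)‖ ≤ 2e²(log k + 5)/r ≤ 160 e² (1 + log k)²`. -/
theorem mexc_norm_deriv_le {k : ℕ} [NeZero k] (ψ : DirichletCharacter ℂ k) (hψ : ψ ≠ 1)
    {β : ℝ} (hβ1 : β ≤ 1) (hβ : 1 - 3 / (16 * (1 + Real.log k)) < β) :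
    ‖deriv ψ.LFunction β‖ ≤ 160 * Real.exp 1 ^ 2 * (1 + Real.log k) ^ 2 := by
  have hk1 : (1 : ℝ) ≤ k := by exact_mod_cast NeZero.one_le
  have hk0 : (0 : ℝ) < k := by linarith
  have hlogk : 0 ≤ Real.log k := Real.log_nonneg hk1
  have hℓ0 : 0 < 1 + Real.log k := by linarith
  set r : ℝ := 1 / (16 * (1 + Real.log k)) with hr
  have hr0 : 0 < r := by positivity
  have hr16 : r ≤ 1 / 16 := by
    rw [hr, div_le_div_iff₀ (by positivity) (by norm_num)]; linarith
  have h3r : 3 / (16 * (1 + Real.log k)) = 3 * r := by rw [hr]; ring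
  rw [h3r] at hβ
  have hη0 : 0 < 4 * r := by positivity
  have hη4 : 4 * r ≤ 1 / 4 := by linarith
  have hdiff := DirichletCharacter.differentiable_LFunction hψ
  have he0 : 0 < Real.exp 1 := Real.exp_pos 1
  have hkη : (k : ℝ) ^ (4 * r) ≤ Real.exp 1 := by
    rw [Real.rpow_def_of_pos hk0]
    refine Real.exp_le_exp.2 ?_
    have : Real.log k * (4 * r) = Real.log k / (4 * (1 + Real.log k)) := by
      rw [hr]; field_simp; ring
    rw [this, div_le_one (by positivity)]; linarith
  have hsph : ∀ z ∈ sphere (β : ℂ) r, ‖ψ.LFunction z‖ ≤ 2 * Real.exp 1 ^ 2 * (Real.log k + 5) := by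
    intro z hz
    rw [mem_sphere, dist_eq_norm] at hz
    have h1 : |(z - β).re| ≤ ‖z - (β : ℂ)‖ := Complex.abs_re_le_norm _
    simp only [Complex.sub_re, Complex.ofReal_re] at h1
    rw [hz] at h1
    have h2 := neg_abs_le (z.re - β)
    have hre : 1 - 4 * r < z.re := by linarith
    have hzn : ‖z‖ ≤ 2 := by
      calc ‖z‖ = ‖(z - β) + β‖ := by ring_nf
        _ ≤ ‖z - (β : ℂ)‖ + ‖(β : ℂ)‖ := norm_add_le _ _
        _ ≤ r + 1 := by
            rw [hz, Complex.norm_real, Real.norm_eq_abs]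
            have : |β| ≤ 1 := abs_le.2 ⟨by linarith, hβ1⟩
            linarith
        _ ≤ 2 := by linarith
    have hb := InvLFunctionDisc.norm_LFunction_le_hybrid ψ hψ hη0 hη4 hre
    have hl5 : 0 ≤ Real.log k + 5 := by linarith
    calc ‖ψ.LFunction z‖ ≤ Real.exp 1 * (k : ℝ) ^ (4 * r) * ‖z‖ * (Real.log k + 5) := hb
      _ ≤ Real.exp 1 * Real.exp 1 * 2 * (Real.log k + 5) := by
          refine mul_le_mul_of_nonneg_right ?_ hl5
          exact mul_le_mul (mul_le_mul_of_nonneg_left hkη he0.le) hzn (norm_nonneg _)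
            (by positivity)
      _ = 2 * Real.exp 1 ^ 2 * (Real.log k + 5) := by ring
  have hC := Complex.norm_deriv_le_of_forall_mem_sphere_norm_le hr0 hdiff.diffContOnCl hsph
  calc ‖deriv ψ.LFunction β‖ ≤ 2 * Real.exp 1 ^ 2 * (Real.log k + 5) / r := hC
    _ = 32 * Real.exp 1 ^ 2 * ((Real.log k + 5) * (1 + Real.log k)) := by
        rw [hr]; field_simp; ring
    _ ≤ 32 * Real.exp 1 ^ 2 * (5 * (1 + Real.log k) ^ 2) := by
        refine mul_le_mul_of_nonneg_left ?_ (by positivity)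
        nlinarith [mul_nonneg hlogk hℓ0.le]
    _ = 160 * Real.exp 1 ^ 2 * (1 + Real.log k) ^ 2 := by ring

/-! ## Bookkeeping of the constants -/

/-- **The choice of `C₁`.**  With `M = 2(3K+1)A(C₀+1)`, `M + 7 ≤ (c/80) D`, `C₁ ≥ D²`,
`C₁ ≥ 6K + 9`: for `x ≥ exp(C₁ (1 + log k)²)` one has `x ≥ 64`, `log k ≤ √log x`, and
`(K log 4k + 1)(A(C₀+1) x e^{−(c/80)√log x} + 1) ≤ x/k⁶`
(`ℓ = 1 + log k`: `k⁶ ℓ M e^{−(c/80)√log x} ≤ e^{(M+7)ℓ − (c/80)√C₁ ℓ} ≤ 1` and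
`2(3K+1) k⁶ ℓ ≤ e^{(6K+9)ℓ} ≤ x`). -/
theorem mexc_final_bound {K A C₀ c D C₁ : ℝ} (hK : 0 ≤ K) (hA : 0 ≤ A) (hC₀ : 0 ≤ C₀)
    (hc : 0 < c) (hD : 2 * (3 * K + 1) * (A * (C₀ + 1)) + 7 ≤ c / 80 * D)
    (hC₁D : D ^ 2 ≤ C₁) (hC₁K : 6 * K + 9 ≤ C₁)
    {k : ℕ} [NeZero k] {x : ℝ} (hx : Real.exp (C₁ * (1 + Real.log k) ^ 2) ≤ x) :
    64 ≤ x ∧ Real.log k ≤ Real.sqrt (Real.log x) ∧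
      (K * (Real.log k + Real.log 4) + 1) *
          (A * (C₀ + 1) * x * Real.exp (-(c / 80 * Real.sqrt (Real.log x))) + 1) ≤
        x / (k : ℝ) ^ 6 := by
  have hk1 : (1 : ℝ) ≤ k := by exact_mod_cast NeZero.one_le
  have hk0 : (0 : ℝ) < k := by linarith
  have hlogk : 0 ≤ Real.log k := Real.log_nonneg hk1
  set ℓ : ℝ := 1 + Real.log k with hℓ
  have hℓ1 : 1 ≤ ℓ := by linarith
  have hℓ0 : 0 < ℓ := by linarith
  have hx0 : 0 < x := (Real.exp_pos _).trans_le hx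
  set X : ℝ := Real.log x with hX
  have hxX : Real.exp X = x := by rw [hX, Real.exp_log hx0]
  have hC₁1 : 1 ≤ C₁ := by linarith
  have hC₁0 : 0 ≤ C₁ := by linarith
  have hXC : C₁ * ℓ ^ 2 ≤ X := by
    rw [hX, ← Real.log_exp (C₁ * ℓ ^ 2)]; exact Real.log_le_log (Real.exp_pos _) hx
  have hℓ2 : ℓ ≤ ℓ ^ 2 := by
    calc ℓ = 1 * ℓ := (one_mul ℓ).symm
      _ ≤ ℓ * ℓ := mul_le_mul_of_nonneg_right hℓ1 hℓ0.le
      _ = ℓ ^ 2 := (sq ℓ).symm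
  have hXC' : C₁ * ℓ ≤ X := le_trans (mul_le_mul_of_nonneg_left hℓ2 hC₁0) hXC
  have hX5 : 5 ≤ X := by
    have : C₁ * 1 ≤ C₁ * ℓ := mul_le_mul_of_nonneg_left hℓ1 hC₁0
    linarith
  have hX0 : 0 ≤ X := by linarith
  -- `x ≥ 64`
  have h64 : 64 ≤ x := by
    calc (64 : ℝ) ≤ Real.exp 5 := MoebiusTwist.sixtyfour_le_exp_five
      _ ≤ Real.exp X := Real.exp_le_exp.2 hX5
      _ = x := hxX
  -- `√X ≥ D ℓ`, `√X ≥ ℓ ≥ log k`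
  have hsD : D * ℓ ≤ Real.sqrt X := by
    refine Real.le_sqrt_of_sq_le ?_
    calc (D * ℓ) ^ 2 = D ^ 2 * ℓ ^ 2 := by ring
      _ ≤ C₁ * ℓ ^ 2 := mul_le_mul_of_nonneg_right hC₁D (by positivity)
      _ ≤ X := hXC
  have hsℓ : ℓ ≤ Real.sqrt X := by
    refine Real.le_sqrt_of_sq_le ?_
    calc ℓ ^ 2 = 1 * ℓ ^ 2 := (one_mul _).symm
      _ ≤ C₁ * ℓ ^ 2 := mul_le_mul_of_nonneg_right hC₁1 (by positivity)
      _ ≤ X := hXC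
  have hlogle : Real.log k ≤ Real.sqrt X := by linarith
  refine ⟨h64, hlogle, ?_⟩
  -- sizes
  set E : ℝ := Real.exp (-(c / 80 * Real.sqrt X)) with hE
  have hE0 : 0 < E := Real.exp_pos _
  have hlog4 : Real.log 4 ≤ 3 := by
    have := Real.log_le_sub_one_of_pos (by norm_num : (0 : ℝ) < 4); linarith
  have hfac : K * (Real.log k + Real.log 4) + 1 ≤ (3 * K + 1) * ℓ := by
    have h1 : Real.log k + Real.log 4 ≤ 3 * ℓ := by rw [hℓ]; linarith
    calc K * (Real.log k + Real.log 4) + 1 ≤ K * (3 * ℓ) + ℓ :=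
          add_le_add (mul_le_mul_of_nonneg_left h1 hK) hℓ1
      _ = (3 * K + 1) * ℓ := by ring
  have hk6 : (k : ℝ) ^ 6 ≤ Real.exp (6 * ℓ) := by
    have : (k : ℝ) ^ 6 = Real.exp (6 * Real.log k) := by
      rw [show (6 : ℝ) * Real.log k = ((6 : ℕ) : ℝ) * Real.log k by norm_num, Real.exp_nat_mul,
        Real.exp_log hk0]
    rw [this]; exact Real.exp_le_exp.2 (by linarith)
  have hℓe : ℓ ≤ Real.exp ℓ := by linarith [Real.add_one_le_exp ℓ]
  have hk6pos : 0 < (k : ℝ) ^ 6 := by positivity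
  -- (a) the error term
  set M : ℝ := 2 * (3 * K + 1) * (A * (C₀ + 1)) with hM
  have hM0 : 0 ≤ M := by positivity
  have hMe : M ≤ Real.exp (M * ℓ) := by
    calc M ≤ M + 1 := by linarith
      _ ≤ Real.exp M := Real.add_one_le_exp M
      _ ≤ Real.exp (M * ℓ) := Real.exp_le_exp.2 (le_mul_of_one_le_right hM0 hℓ1)
  have ha : (k : ℝ) ^ 6 * ((3 * K + 1) * ℓ) * (A * (C₀ + 1)) * E ≤ 1 / 2 := by
    have hprod : M * ((k : ℝ) ^ 6 * ℓ * E) ≤ 1 := by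
      calc M * ((k : ℝ) ^ 6 * ℓ * E)
          ≤ Real.exp (M * ℓ) * (Real.exp (6 * ℓ) * Real.exp ℓ * E) := by
            refine mul_le_mul hMe ?_ (by positivity) (by positivity)
            exact mul_le_mul_of_nonneg_right
              (mul_le_mul hk6 hℓe hℓ0.le (by positivity)) hE0.le
        _ = Real.exp (M * ℓ + 6 * ℓ + ℓ - c / 80 * Real.sqrt X) := by
            rw [hE, ← Real.exp_add, ← Real.exp_add, ← Real.exp_add]
            congr 1; ring
        _ ≤ Real.exp 0 := by
            refine Real.exp_le_exp.2 ?_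
            have h7 : (M + 7) * ℓ ≤ c / 80 * Real.sqrt X := by
              calc (M + 7) * ℓ ≤ c / 80 * D * ℓ := mul_le_mul_of_nonneg_right hD hℓ0.le
                _ = c / 80 * (D * ℓ) := by ring
                _ ≤ c / 80 * Real.sqrt X := mul_le_mul_of_nonneg_left hsD (by positivity)
            have h8 : M * ℓ + 6 * ℓ + ℓ = (M + 7) * ℓ := by ring
            linarith
        _ = 1 := Real.exp_zero
    have : (k : ℝ) ^ 6 * ((3 * K + 1) * ℓ) * (A * (C₀ + 1)) * E =
        M * ((k : ℝ) ^ 6 * ℓ * E) / 2 := by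
      rw [hM]; ring
    rw [this]; linarith
  -- (b) the constant term
  have hb : (k : ℝ) ^ 6 * ((3 * K + 1) * ℓ) ≤ x / 2 := by
    have h2 : 2 * (3 * K + 1) ≤ Real.exp ((6 * K + 2) * ℓ) := by
      calc 2 * (3 * K + 1) ≤ (6 * K + 2) + 1 := by linarith
        _ ≤ Real.exp (6 * K + 2) := Real.add_one_le_exp _
        _ ≤ Real.exp ((6 * K + 2) * ℓ) :=
            Real.exp_le_exp.2 (le_mul_of_one_le_right (by positivity) hℓ1)
    have hprod : 2 * (3 * K + 1) * ((k : ℝ) ^ 6 * ℓ) ≤ x := by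
      calc 2 * (3 * K + 1) * ((k : ℝ) ^ 6 * ℓ)
          ≤ Real.exp ((6 * K + 2) * ℓ) * (Real.exp (6 * ℓ) * Real.exp ℓ) :=
            mul_le_mul h2 (mul_le_mul hk6 hℓe hℓ0.le (by positivity)) (by positivity)
              (by positivity)
        _ = Real.exp ((6 * K + 9) * ℓ) := by
            rw [← Real.exp_add, ← Real.exp_add]
            congr 1; ring
        _ ≤ Real.exp X :=
            Real.exp_le_exp.2 ((mul_le_mul_of_nonneg_right hC₁K hℓ0.le).trans hXC')
        _ = x := hxX
    have : (k : ℝ) ^ 6 * ((3 * K + 1) * ℓ) = 2 * (3 * K + 1) * ((k : ℝ) ^ 6 * ℓ) / 2 := by ring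
    rw [this]; linarith
  -- assemble
  rw [le_div_iff₀ hk6pos]
  have hAE : 0 ≤ A * (C₀ + 1) * x * E + 1 := by positivity
  calc (K * (Real.log k + Real.log 4) + 1) * (A * (C₀ + 1) * x * E + 1) * (k : ℝ) ^ 6
      ≤ ((3 * K + 1) * ℓ) * (A * (C₀ + 1) * x * E + 1) * (k : ℝ) ^ 6 :=
        mul_le_mul_of_nonneg_right (mul_le_mul_of_nonneg_right hfac hAE) hk6pos.le
    _ = x * ((k : ℝ) ^ 6 * ((3 * K + 1) * ℓ) * (A * (C₀ + 1)) * E) +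
          (k : ℝ) ^ 6 * ((3 * K + 1) * ℓ) := by ring
    _ ≤ x * (1 / 2) + x / 2 := add_le_add (mul_le_mul_of_nonneg_left ha hx0.le) hb
    _ = x := by ring

/-! ## The law -/

/-- **The exceptional-character Möbius law** (`MoebiusExcLaw` with absolute constants): for a real
character `ψ ≠ 1 mod k` with a real zero `β ∈ (1 − c₁/log(4k), 1)` of `L(s, ψ)`, `L'(β, ψ)` is real
with `0 < L'(β, ψ) ≤ C₂ (1 + log k)²`, and `‖Mtw ψ x − x^β/(β L'(β, ψ))‖ ≤ x/k⁶` for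
`x ≥ exp(C₁ (1 + log k)²)` (Landau's method with the two poles `s = 1`, `s = β` for
`1 + μ(n)ψ(n)/(K log 4k + 1)`, Montgomery–Vaughan §11.3 Exercises 7–8 with Theorem 11.16; parts
`mexc_excPsiData`, `mexc_deriv_re_pos`, `mexc_norm_deriv_le`, `mexc_final_bound`). -/
theorem moebiusExcLaw : ∃ c₁ C₁ C₂ : ℝ, 0 < c₁ ∧ 0 < C₁ ∧ 0 < C₂ ∧ MoebiusExcLaw c₁ C₁ C₂ := by
  obtain ⟨c, hc, hc2, c₁, hc₁, hc₁4, K, hK, C₀, hC₀, huniq, hdata⟩ := mexc_excPsiData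
  obtain ⟨A, hA, hpsi⟩ := ExcPsiData.exists_psi_bound hc hc2
  -- constants
  obtain ⟨D, hD⟩ : ∃ D : ℝ, D = 80 * (2 * (3 * K + 1) * (A * (C₀ + 1)) + 7) / c := ⟨_, rfl⟩
  have hDeq : 2 * (3 * K + 1) * (A * (C₀ + 1)) + 7 ≤ c / 80 * D := by
    rw [hD]; exact le_of_eq (by field_simp)
  obtain ⟨C₁, hC₁⟩ : ∃ C₁ : ℝ, C₁ = D ^ 2 + (6 * K + 9) + 5 := ⟨_, rfl⟩
  have hD2 : 0 ≤ D ^ 2 := sq_nonneg D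
  have hC₁D : D ^ 2 ≤ C₁ := by rw [hC₁]; linarith
  have hC₁K : 6 * K + 9 ≤ C₁ := by rw [hC₁]; linarith
  have hC₁0 : 0 < C₁ := by linarith
  refine ⟨min c₁ (1 / 8), C₁, 160 * Real.exp 1 ^ 2, lt_min hc₁ (by norm_num), hC₁0,
    by positivity, ?_⟩
  intro k _ ψ hψ hψ2 β hβ hβ1 hL
  have hk1 : (1 : ℝ) ≤ k := by exact_mod_cast NeZero.one_le
  have hk0 : (0 : ℝ) < k := by linarith
  have hlogk : 0 ≤ Real.log k := Real.log_nonneg hk1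
  have hℒ₀1 : 1 ≤ Real.log k + Real.log 4 := PagePNT.one_le_ell0 k
  have hlog4k : Real.log (4 * k) = Real.log k + Real.log 4 := by
    rw [Real.log_mul (by norm_num) hk0.ne', add_comm]
  have hlog4 : 1 ≤ Real.log 4 := by
    rw [← Real.log_exp 1]
    refine Real.log_le_log (Real.exp_pos 1) ?_
    linarith [Real.exp_one_lt_d9]
  rw [hlog4k] at hβ
  have hmin2 : min c₁ (1 / 8) ≤ 1 / 8 := min_le_right _ _
  have hβc : 1 - 2 * c₁ / (Real.log k + Real.log 4) < β := by
    have : min c₁ (1 / 8) / (Real.log k + Real.log 4) ≤ 2 * c₁ / (Real.log k + Real.log 4) :=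
      div_le_div_of_nonneg_right (by linarith [min_le_left c₁ (1 / 8)]) (by linarith)
    linarith
  have hβr : 1 - 3 / (16 * (1 + Real.log k)) < β := by
    have h1 : min c₁ (1 / 8) / (Real.log k + Real.log 4) ≤ (1 / 8) / (1 + Real.log k) :=
      calc min c₁ (1 / 8) / (Real.log k + Real.log 4) ≤ (1 / 8) / (Real.log k + Real.log 4) :=
            div_le_div_of_nonneg_right hmin2 (by linarith)
        _ ≤ (1 / 8) / (1 + Real.log k) :=
            div_le_div_of_nonneg_left (by norm_num) (by linarith) (by linarith)
    have h2 : (1 / 8) / (1 + Real.log k) < 3 / (16 * (1 + Real.log k)) := by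
      rw [div_lt_div_iff₀ (by linarith) (by positivity)]; linarith
    linarith
  obtain ⟨hd, -, -, F, hF⟩ := hdata k ψ hψ hψ2 1 (by simp) β hβc hL
  -- positivity and size of `L'(β, ψ)`
  have hno : ∀ σ : ℝ, β < σ → σ ≤ 1 → ψ.LFunction σ ≠ 0 := by
    intro σ h1 h2 h0
    have := huniq k ψ hψ β σ hL h0 hβc (by linarith)
    linarith
  have hβ0 : 0 < β := by linarith [hF.β_ge]
  have hpos : 0 < (deriv ψ.LFunction β).re := mexc_deriv_re_pos ψ hψ hψ2 hβ0 hβ1 hL hd hno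
  refine ⟨hpos, (Complex.re_le_norm _).trans (mexc_norm_deriv_le ψ hψ hβ1.le hβr),
    fun x hx ↦ ?_⟩
  -- the asymptotic formula
  obtain ⟨hx64, hlogle, hnum⟩ := mexc_final_bound hK hA.le hC₀ hc hDeq hC₁D hC₁K hx
  have hx0 : 0 < x := by linarith
  have hb := hpsi hF x hx64 hlogle
  rw [MoebiusTwist.psi_coeff_eq] at hb
  simp only [Complex.one_re, mul_one, one_mul] at hb
  set lam : ℝ := 1 / (K * (Real.log k + Real.log 4) + 1) with hlam
  set S : ℂ := ∑ n ∈ Finset.Ioc 0 ⌊x⌋₊, ψ (n : ZMod k) * (μ n : ℂ) with hS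
  set E : ℝ := Real.exp (-(c / 80 * Real.sqrt (Real.log x))) with hE
  set d : ℝ := (deriv ψ.LFunction β).re with hd_def
  set α₀ : ℝ := ((deriv ψ.LFunction β)⁻¹).re with hα₀
  have hden : 0 < K * (Real.log k + Real.log 4) + 1 := by positivity
  have hlam0 : 0 < lam := by rw [hlam]; positivity
  have him : (deriv ψ.LFunction β).im = 0 := MoebiusTwist.deriv_LFunction_ofReal_im ψ hψ hψ2 β
  have hdne : d ≠ 0 := hpos.ne'
  have hα₀d : α₀ = 1 / d := by
    rw [hα₀, Complex.inv_re, Complex.normSq_apply, him, mul_zero, add_zero, ← hd_def]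
    field_simp
  have hfloor : |(⌊x⌋₊ : ℝ) - x| ≤ 1 := by
    rw [abs_sub_comm, abs_of_nonneg (sub_nonneg.2 (Nat.floor_le hx0.le))]
    exact (sub_lt_iff_lt_add.2 (by linarith [Nat.lt_floor_add_one x])).le
  have hkey : lam * |S.re - α₀ * x ^ β / β| ≤ A * (C₀ + 1) * x * E + 1 := by
    have heq : lam * (S.re - α₀ * x ^ β / β) =
        ((⌊x⌋₊ : ℝ) + lam * S.re - (x - -(lam * α₀) * x ^ β / β)) + (x - ⌊x⌋₊) := by ring
    rw [← abs_of_pos hlam0, ← abs_mul, heq]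
    refine (abs_add_le _ _).trans (add_le_add hb ?_)
    rw [abs_sub_comm]; exact hfloor
  have hMtw : Mtw ψ x = (((Mtw ψ x).re : ℝ) : ℂ) :=
    Complex.ext (by simp) (by simp [mexc_Mtw_im hψ2 x])
  have hMtwS : (Mtw ψ x).re = S.re := by rw [mexc_Mtw_eq]
  have hm : x ^ β / (β * d) = α₀ * x ^ β / β := by
    rw [hα₀d]; field_simp
  rw [hMtw, hMtwS, hm, ← Complex.ofReal_sub, Complex.norm_real, Real.norm_eq_abs]
  calc |S.re - α₀ * x ^ β / β|
      = (K * (Real.log k + Real.log 4) + 1) * (lam * |S.re - α₀ * x ^ β / β|) := by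
        rw [hlam]; field_simp
    _ ≤ (K * (Real.log k + Real.log 4) + 1) * (A * (C₀ + 1) * x * E + 1) :=
        mul_le_mul_of_nonneg_left hkey hden.le
    _ ≤ x / (k : ℝ) ^ 6 := hnum

end Summit.Parity.GeneralizedHardyLittlewood.Theorems.DilatedChowla.Negative

end
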